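import Summits.CriticalPhenomena.PercolationContinuityZ3.Theorems.PercNearOneGluingNoHeavyLowerTailMajorityGluingWindowBelowCore
import HarnessLib

/-!
# The arithmetic core of the CONVEX BOOTSTRAP (lane prim-rate, constants-miner 1, gens 25–26; CONVEX-BOOTSTRAP.md §2, RIGOROUS-CERTIFICATION.md)

Support file for the closed crux `NoHeavyLowerTail` (stmt-CriticalPhenomena-4575), majority-gluing line (the weak `(4,3)` cell
`(1 − M)·μ(≥ 3 of 4 relays cut) ≤ M` on the window `M ≤ 13/256`).  The lane bounds the cell by finitely many CONVEX programmes
obtained from the percolation rows after the scaling `x = M^s · x̂` of the scale-free law.  Two real-arithmetic facts carry the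
whole construction and are proved here once and for all:

* `iso_scaled` — the SCALING LEMMA: an isolation row `u^c ≤ M^b · ρ · π₁ · π₂` with a bounded support `ρ ≤ 1` becomes, for the
  scaled masses `u = M^s û`, `πᵢ = M^s π̂ᵢ`, the row `û^c ≤ M^(b + 2s − c s) · π̂₁ · π̂₂`; and `iso3_exponent_sqrt3` — with the
  three-point exponent `c₃ = (3 + √3)/2`, `b₃ = 3 − c₃` and `s = √3` the exponent `b₃ + 2s − c₃ s` VANISHES: the scaled hub row is
  exactly scale-free (CONVEX-BOOTSTRAP §2 (ii), DERIVATIONS P1);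
* `star_iso4_exponent_s0` — with the four-point exponent `c₄ = (3 + √(11/3))/2`, `p = 1/c₄`, `κ₀ = (4 − c₄)/c₄ = 4p − 1`, the
  STAR∘ISO₄ row scales with `M^(κ₀ + (4p − 2)s)`; at `s₀ := κ₀/(2 − 4p)` this exponent vanishes (the μ-free, M-UNIFORM programmes
  of gen 26), `1 < s₀` (so every certified bound `E ≤ C·M^(s₀·k)`, `k ≥ 1`, beats `M` for small `M`) and `2 − 4p > 0`.
Also the two closed forms used by every certificate reader: `1/c₃ = 1 − √3/3` and `b₃/c₃ = 2 − √3` (`c3_pos`, `three_div_c3` are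
reused from `…WindowBelowCore`).
Pure real arithmetic; no percolation, no definitions, no named facts, no sorries. [cite: VandenbergHaggstromKahn2005, Thm. 1.3 (p. 6)]
-/

noncomputable section

namespace Summit.CriticalPhenomena.PercolationContinuityZ3.Theorems

namespace HubOnly
namespace ConvexBootstrap

open Real

/-! ### The scaling lemma -/

/-- **SCALING LEMMA.**  If `u^c ≤ M^b·ρ·π₁·π₂` with `0 < M`, a bounded support `ρ ≤ 1` and the scaled masses
`u = M^s·û`, `π₁ = M^s·π̂₁`, `π₂ = M^s·π̂₂` (`û, π̂₁, π̂₂ ≥ 0`), then `û^c ≤ M^(b + 2s − c·s)·π̂₁·π̂₂` (any real `b, c, s`). -/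
theorem iso_scaled {M u uh ρ π₁ π₂ p₁ p₂ b c s : ℝ} (hM : 0 < M)
    (huh : 0 ≤ uh) (hp₁ : 0 ≤ p₁) (hp₂ : 0 ≤ p₂) (hρ1 : ρ ≤ 1)
    (hu : u = M ^ s * uh) (h₁ : π₁ = M ^ s * p₁) (h₂ : π₂ = M ^ s * p₂)
    (hiso : u ^ c ≤ M ^ b * ρ * π₁ * π₂) :
    uh ^ c ≤ M ^ (b + 2 * s - c * s) * p₁ * p₂ := by
  have hMs : 0 < M ^ s := Real.rpow_pos_of_pos hM s
  have hMsc : 0 < M ^ (s * c) := Real.rpow_pos_of_pos hM _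
  -- left side: u^c = M^(s c) · û^c
  have hl : u ^ c = M ^ (s * c) * uh ^ c := by
    rw [hu, Real.mul_rpow (le_of_lt hMs) huh, ← Real.rpow_mul (le_of_lt hM)]
  -- right side: M^b ρ π₁ π₂ ≤ M^b π₁ π₂ = M^(s c) · (M^(b + 2 s − c s) p₁ p₂)
  have hr : M ^ b * ρ * π₁ * π₂ ≤ M ^ (s * c) * (M ^ (b + 2 * s - c * s) * p₁ * p₂) := by
    have hππ : 0 ≤ π₁ * π₂ := by rw [h₁, h₂]; positivity
    have hMb : 0 ≤ M ^ b := le_of_lt (Real.rpow_pos_of_pos hM b)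
    have step1 : M ^ b * ρ * π₁ * π₂ ≤ M ^ b * π₁ * π₂ := by
      have : M ^ b * ρ * (π₁ * π₂) ≤ M ^ b * 1 * (π₁ * π₂) := by
        apply mul_le_mul_of_nonneg_right _ hππ
        exact mul_le_mul_of_nonneg_left hρ1 hMb
      simpa [mul_assoc] using this
    have heq : M ^ b * π₁ * π₂ = M ^ (s * c) * (M ^ (b + 2 * s - c * s) * p₁ * p₂) := by
      rw [h₁, h₂]
      have e : M ^ b * (M ^ s * p₁) * (M ^ s * p₂) = (M ^ b * M ^ s * M ^ s) * p₁ * p₂ := by ring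
      have e2 : M ^ (s * c) * (M ^ (b + 2 * s - c * s) * p₁ * p₂) = (M ^ (s * c) * M ^ (b + 2 * s - c * s)) * p₁ * p₂ := by ring
      rw [e, e2, ← Real.rpow_add hM, ← Real.rpow_add hM, ← Real.rpow_add hM]
      congr 2; ring_nf
    exact step1.trans (le_of_eq heq)
  have h := hiso
  rw [hl] at h
  exact le_of_mul_le_mul_left (h.trans hr) hMsc

/-! ### The three-point exponent: the scaled hub ISO₃ row is exactly scale-free at `s = √3` -/

open WindowBelow (c3_pos)

/-- The closed form of the hub-triple tangent exponent: `1/c₃ = 1 − √3/3`. -/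
theorem inv_c3 : 1 / ((3 + Real.sqrt 3) / 2) = 1 - Real.sqrt 3 / 3 := by
  have h3 : Real.sqrt 3 * Real.sqrt 3 = 3 := Real.mul_self_sqrt (by norm_num)
  rw [div_eq_iff (ne_of_gt c3_pos)]
  nlinarith [h3]

/-- The fixed-`M` hub-row constant exponent: `b₃/c₃ = (3 − c₃)/c₃ = 2 − √3`. -/
theorem b3_div_c3 : (3 - (3 + Real.sqrt 3) / 2) / ((3 + Real.sqrt 3) / 2) = 2 - Real.sqrt 3 := by
  have h3 : Real.sqrt 3 * Real.sqrt 3 = 3 := Real.mul_self_sqrt (by norm_num)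
  rw [div_eq_iff (ne_of_gt c3_pos)]
  nlinarith [h3]

/-- **The exact cancellation (CONVEX-BOOTSTRAP §2 (ii)).**  With `c₃ = (3+√3)/2`, `b₃ = 3 − c₃`, `s = √3`:
`b₃ + 2s − c₃·s = 0`. -/
theorem iso3_exponent_sqrt3 :
    (3 - (3 + Real.sqrt 3) / 2) + 2 * Real.sqrt 3 - (3 + Real.sqrt 3) / 2 * Real.sqrt 3 = 0 := by
  have h3 : Real.sqrt 3 * Real.sqrt 3 = 3 := Real.mul_self_sqrt (by norm_num)
  nlinarith [h3]

/-- Equivalently `(b₃ + 2√3)/c₃ = √3`: the scaling exponent at which the hub ISO₃ row is scale-free. -/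
theorem b3_add_two_sqrt3_div_c3 :
    ((3 - (3 + Real.sqrt 3) / 2) + 2 * Real.sqrt 3) / ((3 + Real.sqrt 3) / 2) = Real.sqrt 3 := by
  have h3 : Real.sqrt 3 * Real.sqrt 3 = 3 := Real.mul_self_sqrt (by norm_num)
  rw [div_eq_iff (ne_of_gt c3_pos)]
  nlinarith [h3]

/-- **The scaled hub row.**  From the three-point isolation row `u^{c₃} ≤ M^{b₃}·ρ₀·π₁·π₂` with `ρ₀ ≤ 1` and the scaling
`x = M^{√3}·x̂`: `û^{c₃} ≤ π̂₁·π̂₂` — no power of `M` survives. -/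
theorem hub_iso3_scaled {M u uh ρ π₁ π₂ p₁ p₂ : ℝ} (hM : 0 < M)
    (huh : 0 ≤ uh) (hp₁ : 0 ≤ p₁) (hp₂ : 0 ≤ p₂) (hρ1 : ρ ≤ 1)
    (hu : u = M ^ Real.sqrt 3 * uh) (h₁ : π₁ = M ^ Real.sqrt 3 * p₁) (h₂ : π₂ = M ^ Real.sqrt 3 * p₂)
    (hiso : u ^ ((3 + Real.sqrt 3) / 2) ≤ M ^ (3 - (3 + Real.sqrt 3) / 2) * ρ * π₁ * π₂) :
    uh ^ ((3 + Real.sqrt 3) / 2) ≤ p₁ * p₂ := by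
  have h := iso_scaled (b := 3 - (3 + Real.sqrt 3) / 2) (s := Real.sqrt 3) hM huh hp₁ hp₂ hρ1 hu h₁ h₂ hiso
  rw [iso3_exponent_sqrt3, Real.rpow_zero, one_mul] at h
  exact h

/-! ### The four-point exponent and the μ-free scaling `s₀` -/

/-- `c₄ = (3 + √(11/3))/2 > 2` (indeed `√(11/3) > 1`). -/
theorem two_lt_c4 : 2 < (3 + Real.sqrt (11 / 3)) / 2 := by
  have h1 : 1 < Real.sqrt (11 / 3) := by
    rw [show (1:ℝ) = Real.sqrt 1 by simp]
    exact Real.sqrt_lt_sqrt (by norm_num) (by norm_num)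
  linarith

/-- `c₄ < 8/3` (since `√(11/3) < 7/3`, i.e. `11/3 < 49/9`). -/
theorem c4_lt : (3 + Real.sqrt (11 / 3)) / 2 < 8 / 3 := by
  have h1 : Real.sqrt (11 / 3) < 7 / 3 := by
    rw [show (7:ℝ) / 3 = Real.sqrt ((7 / 3) ^ 2) by rw [Real.sqrt_sq]; norm_num]
    exact Real.sqrt_lt_sqrt (by norm_num) (by norm_num)
  linarith

/-- `κ₀ = (4 − c₄)/c₄ = 4p − 1` with `p = 1/c₄`. -/
theorem kappa0_eq (c : ℝ) (hc : 0 < c) : (4 - c) / c = 4 * (1 / c) - 1 := by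
  field_simp

/-- `2 − 4p > 0` for `p = 1/c₄` (because `c₄ > 2`): the denominator of `s₀` is positive. -/
theorem two_sub_four_p_pos : 0 < 2 - 4 * (1 / ((3 + Real.sqrt (11 / 3)) / 2)) := by
  have hc := two_lt_c4
  have hcpos : 0 < (3 + Real.sqrt (11 / 3)) / 2 := by linarith
  rw [sub_pos, show 4 * (1 / ((3 + Real.sqrt (11 / 3)) / 2)) = 4 / ((3 + Real.sqrt (11 / 3)) / 2) by ring,
    div_lt_iff₀ hcpos]
  linarith

/-- **The μ-free scaling.**  For any `κ₀` and `p` with `2 − 4p ≠ 0`, `s₀ := κ₀/(2 − 4p)` kills the STAR∘ISO₄ exponent: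
`κ₀ + (4p − 2)·s₀ = 0`. -/
theorem star_iso4_exponent_s0 (κ₀ p : ℝ) (h : 2 - 4 * p ≠ 0) :
    κ₀ + (4 * p - 2) * (κ₀ / (2 - 4 * p)) = 0 := by
  have hs : κ₀ / (2 - 4 * p) * (2 - 4 * p) = κ₀ := div_mul_cancel₀ κ₀ h
  linear_combination (-1 : ℝ) * hs

/-- At `s₀` the world-A exponent is `κ₀ + 4p·s₀ = 2·s₀` and the world-B exponent is `κ₀ + 3p·s₀ = (2 − p)·s₀`. -/
theorem exponents_at_s0 (κ₀ p : ℝ) (h : 2 - 4 * p ≠ 0) :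
    κ₀ + 4 * p * (κ₀ / (2 - 4 * p)) = 2 * (κ₀ / (2 - 4 * p)) ∧
      κ₀ + 3 * p * (κ₀ / (2 - 4 * p)) = (2 - p) * (κ₀ / (2 - 4 * p)) := by
  have hs : κ₀ / (2 - 4 * p) * (2 - 4 * p) = κ₀ := div_mul_cancel₀ κ₀ h
  constructor
  · linear_combination (-1 : ℝ) * hs
  · linear_combination (-1 : ℝ) * hs

/-- **`1 < s₀`** for the lane's constants: with `c₄ = (3+√(11/3))/2`, `p = 1/c₄`, `κ₀ = 4p − 1`,
`s₀ = κ₀/(2 − 4p) > 1` (equivalently `8p > 3`, i.e. `c₄ < 8/3`).  Hence every μ-free certificate `E ≤ C·M^{k·s₀}` (`k ≥ 1`)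
is `≤ M` for all small `M`. -/
theorem one_lt_s0 :
    1 < (4 * (1 / ((3 + Real.sqrt (11 / 3)) / 2)) - 1) / (2 - 4 * (1 / ((3 + Real.sqrt (11 / 3)) / 2))) := by
  have hd := two_sub_four_p_pos
  rw [lt_div_iff₀ hd, one_mul]
  -- need: 2 - 4p < 4p - 1, i.e. 3 < 8p, i.e. 3 c₄ < 8
  have hc := c4_lt
  have hcpos : 0 < (3 + Real.sqrt (11 / 3)) / 2 := lt_trans (by norm_num) two_lt_c4
  have hp : 3 / 8 < 1 / ((3 + Real.sqrt (11 / 3)) / 2) := by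
    rw [div_lt_div_iff₀ (by norm_num) hcpos]
    linarith
  linarith

end ConvexBootstrap
end HubOnly

end Summit.CriticalPhenomena.PercolationContinuityZ3.Theorems
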